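import Summits.HubbardSuperconductivity.HubbardSuperconductivity.Theorems.NodalWardXYPerturbedXYOrderGinibreRay
import Summits.HubbardSuperconductivity.HubbardSuperconductivity.Theorems.NodalWardXYPerturbedXYOrderExp3BlockBounds
import Summits.HubbardSuperconductivity.HubbardSuperconductivity.Theorems.NodalWardXYPerturbedXYOrderExp3L2Rigidity
import Summits.HubbardSuperconductivity.HubbardSuperconductivity.Theorems.NodalWardXYPerturbedXYOrderExp3LocalRigidity
import Summits.HubbardSuperconductivity.HubbardSuperconductivity.Theorems.NodalWardXYPerturbedXYOrderExp3Kernel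
import Summits.HubbardSuperconductivity.HubbardSuperconductivity.Theorems.NodalWardXYPerturbedXYOrderExp3Laplace
import Summits.HubbardSuperconductivity.HubbardSuperconductivity.Theorems.NodalWardXYPerturbedXYOrderExp3HelixBox

/-!
# Crux `PerturbedXYOrder` (stmt-HubbardSuperconductivity-10739): the decay exponent `4` is load-bearing —
# the crux with envelope `(1 + dist)⁻³` is FALSE (lead c5, line `schwarz-inheritance`; stub `stub_e3ExponentThreeFalse`)

The crux `Theses.NodalWardXY.PerturbedXYOrder` bounds the two-current kernel by `ε (1 + dist(x,x'))⁻⁴`.  The standing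
disprover recorded (Cruxes/PerturbedXYOrder/Disproof.lean §2, variant `PerturbedXYOrderExp 3`) the PAPER verdict that the
same statement with exponent `3` fails for every `J₀, ε, a` ("90°-helix domination; not formalised: needs quantitative
Laplace concentration on `[0,2π]^{L³}`").  This file proves it, over the vocabulary of `Theorems/NodalWardXYDefs.lean`
(definitionally the crux's own `let`s, so the statement below is `¬ PerturbedXYOrderExp 3` up to unfolding).

Proof (all ingredients landed as registered stubs of the line, this seat):
* `stub_e3Kernel` — the explicit real, non-negative block kernel
  `κ(x,x') = εc Σ_{n<N} #{(y,y') ∈ Q_n² : x' + ιy = x + ιy'} / 2^{6n}`, `c = 1/512`, is admissible with exponent `3` for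
  `2^N ≤ L`, and `W_κ(θ) = εc Σ_{n<N} S_n(θ)` exactly, `S_n(θ) = Σ_z (B_n j_θ)(z)²` the squared `2ⁿ`-block averages of
  the site current `j_θ(z) = Σ_i sin ∇_iθ(z)`;
* `stub_e3BlockBounds`, `stub_e3L2Rigidity`, `stub_e3LocalRigidity` — `S_{n+1} ≤ S_n ≤ 9L³`; if `S_2 ≥ (1−ρ)9L³` then
  `j_θ` is `ℓ²`-close to a smooth function and `≈ ±3`, hence locally a 90°-helix, hence `Σ_{x,y} cos(θ_x−θ_y) < (a/2)L⁶`;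
  so on the magnetised set `W_κ ≤ 9εcL³(N(1−ρ) + 2ρ)`;
* `stub_e3HelixBox` — on the `δ`-box around the 90°-helix representative (`4 ∣ L`) every current is `≥ 1 − 2δ²` and every
  bond cosine `≥ −2δ`, so there `W_κ ≥ 9εcL³N(1−2δ²)²` and `JΣcos ≥ −6δJL³`;
* `stub_e3Laplace` — energy–entropy on the cube: the plateau is `≤ a/2 + (π/δ)^{L³} e^{R_A − R_N}`;
* choice of parameters: `J = max J₀ 0`, `ρ' = min ρ ½`, `δ = min ½ (√ρ'/4)`, `N ≥ 8` with
  `(9/2)εcρ'N ≥ log(π/δ) + 3J(1+2δ) + 1` and `N > log(2/a)`, `L = 2^N`: then `R_A − R_N ≤ L³(3J(1+2δ) − (9/2)εcρ'N)`, the error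
  term is `≤ e^{−L³} ≤ e^{−N} < a/2`, and the plateau is `< a` — contradicting the `p = 3` claim for the admissible `κ`.
-/

noncomputable section

namespace Summit.HubbardSuperconductivity.HubbardSuperconductivity.Theorems.PerturbedXYOrder

open MeasureTheory Literature.Probability.LatticeModels Finset
open Summit.HubbardSuperconductivity.HubbardSuperconductivity.Theses.NodalWardXY

/-! ### Scalar bookkeeping for the choice of parameters -/

/-- The bracket `N(1−ρ) + 2ρ − N m² ≤ −Nρ/2` once `N ≥ 8`, `m² ≥ 1 − 4δ²` and `δ² ≤ ρ/16`. -/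
theorem e3a_bracket_le {N ρ δ m : ℝ} (hN : 8 ≤ N) (hρ : 0 ≤ ρ) (hm : 1 - 4 * δ ^ 2 ≤ m ^ 2)
    (hδ : δ ^ 2 ≤ ρ / 16) : N * (1 - ρ) + 2 * ρ - N * m ^ 2 ≤ -(N * ρ) / 2 := by
  have h1 : N * (1 - 4 * δ ^ 2) ≤ N * m ^ 2 := mul_le_mul_of_nonneg_left hm (by linarith)
  have h2 : 4 * N * δ ^ 2 ≤ N * ρ / 4 := by nlinarith
  nlinarith

/-- `(2p)^n e^A / ((2d)^n e^B) = (p/d)^n e^{A−B}`. -/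
theorem e3a_ratio_eq (p d : ℝ) (n : ℕ) (A B : ℝ) :
    (2 * p) ^ n * Real.exp A / ((2 * d) ^ n * Real.exp B) = (p / d) ^ n * Real.exp (A - B) := by
  rw [Real.exp_sub, mul_div_mul_comm, ← div_pow, mul_div_mul_left _ _ (two_ne_zero' ℝ)]

/-- `qⁿ e^A = e^{n log q + A} ≤ e^t` when `n log q + A ≤ t` (`q > 0`). -/
theorem e3a_pow_mul_exp_le {q : ℝ} (hq : 0 < q) (n : ℕ) {A t : ℝ} (h : (n : ℝ) * Real.log q + A ≤ t) :
    q ^ n * Real.exp A ≤ Real.exp t := by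
  calc q ^ n * Real.exp A = Real.exp ((n : ℝ) * Real.log q + A) := by
        rw [Real.exp_add, Real.exp_nat_mul, Real.exp_log hq]
    _ ≤ Real.exp t := Real.exp_le_exp.2 h

/-- `e^{−N} < a/2` once `N > log(2/a)`. -/
theorem e3a_exp_neg_lt {N a : ℝ} (ha : 0 < a) (hN : Real.log (2 / a) < N) : Real.exp (-N) < a / 2 := by
  have h1 : Real.log (2 / a) = -Real.log (a / 2) := by
    rw [← Real.log_inv, inv_div]
  calc Real.exp (-N) < Real.exp (Real.log (a / 2)) := Real.exp_lt_exp.2 (by linarith)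
    _ = a / 2 := Real.exp_log (by positivity)

/-- The exponent bookkeeping: `L³ log q + (R_A − R_N) ≤ −N`. -/
theorem e3a_exponent_le {L3 lq J δ κN A0 D Nr : ℝ} (hNr : Nr ≤ L3) (hL3 : 0 ≤ L3)
    (hA0 : A0 = lq + 3 * J * (1 + 2 * δ) + 1) (hκ : A0 ≤ κN) (hD : D ≤ L3 * (3 * J * (1 + 2 * δ) - κN)) :
    L3 * lq + D ≤ -Nr := by
  have h1 : L3 * lq + D ≤ L3 * (A0 - κN) - L3 := by rw [hA0]; nlinarith
  have h2 : L3 * (A0 - κN) ≤ 0 := mul_nonpos_of_nonneg_of_nonpos hL3 (by linarith)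
  linarith

/-- `Σ_{n<N} f = f 0 + f 1 + Σ_{2 ≤ n < N} f` for `N ≥ 2`. -/
theorem e3a_sum_range_split (f : ℕ → ℝ) {N : ℕ} (hN : 2 ≤ N) :
    ∑ n ∈ Finset.range N, f n = (f 0 + f 1) + ∑ n ∈ Finset.Ico 2 N, f n := by
  rw [Finset.range_eq_Ico, ← Finset.sum_Ico_consecutive f (Nat.zero_le 2) hN]
  congr 1
  rw [Finset.sum_Ico_eq_sum_range]
  simp only [Finset.sum_range_succ, Finset.sum_range_zero, zero_add]

/-- **The crux with decay exponent `3` is FALSE** (registered composition `stub_e3ExponentThreeFalse`; see the module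
docstring for the proof).  The decay exponent `4` of `PerturbedXYOrder` is therefore load-bearing: it cannot be lowered
to `3`. -/
theorem stub_e3ExponentThreeFalse :
    ¬ (∃ J₀ ε a : ℝ, 0 < ε ∧ 0 < a ∧ ∀ J : ℝ, J₀ ≤ J → ∀ (L : ℕ) [NeZero L], 2 ≤ L →
        ∀ K : Bond L → Bond L → ℂ,
          (∀ b b', ‖K b b'‖ ≤ ε / (1 + ((torusGraph 3 L).dist b.1 b'.1 : ℝ)) ^ 3) →
            Zk J K ≠ 0 ∧ a ≤ (cratio L J K).re) := by
  rintro ⟨J₀, ε, a, hε, ha, h⟩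
  /- 1. Parameters. -/
  set J : ℝ := max J₀ 0 with hJdef
  have hJ0 : 0 ≤ J := le_max_right _ _
  obtain ⟨ρ, hρ, hrig⟩ := stub_e3LocalRigidity a ha
  set ρ' : ℝ := min ρ (1 / 2) with hρ'def
  have hρ'pos : 0 < ρ' := lt_min hρ (by norm_num)
  have hρ'le : ρ' ≤ ρ := min_le_left _ _
  have hρ'half : ρ' ≤ 1 / 2 := min_le_right _ _
  -- local rigidity at the smaller parameter `ρ'`
  have hrig' : ∀ (L : ℕ) [NeZero L] (θ : TorusSite 3 L → ℝ) (n : ℕ), 2 ≤ n →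
      (∑ x : TorusSite 3 L, ((∑ i : Fin 3, cur (x, i) θ) -
        ((∑ y : Fin 3 → Fin (2 ^ n), ∑ y' : Fin 3 → Fin (2 ^ n), ∑ i : Fin 3,
          cur (x + (fun k => ((y' k : ℕ) : ZMod L)) - (fun k => ((y k : ℕ) : ZMod L)), i) θ) /
            (2 : ℝ) ^ (6 * n))) ^ 2 ≤ 9 * ρ' * (L : ℝ) ^ 3) →
      ((1 - ρ') * (9 * (L : ℝ) ^ 3) ≤ ∑ x : TorusSite 3 L, (∑ i : Fin 3, cur (x, i) θ) ^ 2) →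
      (∑ x : TorusSite 3 L, ∑ y : TorusSite 3 L, Real.cos (θ x - θ y)) < a / 2 * (L : ℝ) ^ 6 := by
    intro L _ θ n hn h1 h2
    refine hrig L θ n hn (h1.trans ?_) (le_trans ?_ h2)
    · have : (0:ℝ) ≤ (L : ℝ) ^ 3 := by positivity
      nlinarith
    · have : (0:ℝ) ≤ (L : ℝ) ^ 3 := by positivity
      nlinarith
  set δ : ℝ := min (1 / 2) (Real.sqrt ρ' / 4) with hδdef
  have hδpos : 0 < δ := lt_min (by norm_num) (by positivity)
  have hδhalf : δ ≤ 1 / 2 := min_le_left _ _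
  have hδpi : δ ≤ Real.pi / 4 := hδhalf.trans (by linarith [Real.pi_gt_three])
  have hδsq : δ ^ 2 ≤ ρ' / 16 := by
    have h1 : δ ≤ Real.sqrt ρ' / 4 := min_le_right _ _
    have h2 : δ ^ 2 ≤ (Real.sqrt ρ' / 4) ^ 2 := pow_le_pow_left₀ hδpos.le h1 2
    rw [div_pow, Real.sq_sqrt hρ'pos.le] at h2
    linarith
  set c : ℝ := 1 / 512 with hcdef
  have hc0 : (0:ℝ) ≤ c := by norm_num [hcdef]
  set κ₀ : ℝ := 9 / 2 * ε * c * ρ' with hκ₀def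
  have hκ₀ : 0 < κ₀ := by positivity
  set A₀ : ℝ := Real.log (Real.pi / δ) + 3 * J * (1 + 2 * δ) + 1 with hA₀def
  set N : ℕ := max 8 (max ⌈A₀ / κ₀⌉₊ (⌈Real.log (2 / a)⌉₊ + 1)) with hNdef
  have hN8 : 8 ≤ N := le_max_left _ _
  have hNA : A₀ ≤ κ₀ * N := by
    have h1 : (⌈A₀ / κ₀⌉₊ : ℝ) ≤ N := by exact_mod_cast (le_max_left _ _).trans (le_max_right 8 _)
    have h2 : A₀ / κ₀ ≤ ⌈A₀ / κ₀⌉₊ := Nat.le_ceil _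
    rw [div_le_iff₀ hκ₀] at h2
    nlinarith
  have hNa : Real.log (2 / a) < N := by
    have h1 : ((⌈Real.log (2 / a)⌉₊ + 1 : ℕ) : ℝ) ≤ N := by
      exact_mod_cast (le_max_right _ _).trans (le_max_right 8 _)
    have h2 : Real.log (2 / a) ≤ ⌈Real.log (2 / a)⌉₊ := Nat.le_ceil _
    push_cast at h1
    linarith
  /- 2. The volume `L = 2^N`. -/
  obtain ⟨L, hLdef⟩ : ∃ L : ℕ, L = 2 ^ N := ⟨_, rfl⟩
  haveI : NeZero L := ⟨by rw [hLdef]; positivity⟩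
  have hL2 : 2 ≤ L := by
    rw [hLdef]
    calc (2:ℕ) = 2 ^ 1 := by norm_num
      _ ≤ 2 ^ N := Nat.pow_le_pow_right (by norm_num) (by omega)
  have h4 : 4 ∣ L := by
    rw [hLdef]
    obtain ⟨M, hM⟩ : ∃ M, N = M + 2 := ⟨N - 2, by omega⟩
    exact ⟨2 ^ M, by rw [hM, pow_add]; ring⟩
  have hNL : 2 ^ N ≤ L := hLdef ▸ le_rfl
  have hLN : (N : ℝ) ≤ (L : ℝ) := by
    rw [hLdef]; exact_mod_cast (Nat.lt_two_pow_self).le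
  have hLpos : (0:ℝ) < (L : ℝ) := by exact_mod_cast NeZero.pos L
  have hL1 : (1:ℝ) ≤ (L : ℝ) := by exact_mod_cast NeZero.one_le
  have hL3 : (L : ℝ) ≤ (L : ℝ) ^ 3 := by
    calc (L:ℝ) = (L:ℝ) * 1 * 1 := by ring
      _ ≤ (L:ℝ) * L * L := by gcongr
      _ = (L:ℝ) ^ 3 := by ring
  have hcardΛ : Fintype.card (TorusSite 3 L) = L ^ 3 := by
    rw [Fintype.card_fun, ZMod.card, Fintype.card_fin]
  have hcardB : (Fintype.card (Bond L) : ℝ) = 3 * (L : ℝ) ^ 3 := by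
    rw [Fintype.card_prod, hcardΛ, Fintype.card_fin]; push_cast; ring
  /- 3. The kernel. -/
  obtain ⟨hadm, hW, -⟩ := stub_e3Kernel L N hNL ε c hε.le hc0 (by norm_num [hcdef])
  /- 4. The main estimate, for any kernel with these two properties. -/
  suffices main : ∀ K : Bond L → Bond L → ℂ,
      (∀ b b' : Bond L, ‖K b b'‖ ≤ ε / (1 + ((torusGraph 3 L).dist b.1 b'.1 : ℝ)) ^ 3) →
      (∀ θ : TorusSite 3 L → ℝ, Wk K θ =
        ((ε * c * ∑ n ∈ Finset.range N, (∑ z : TorusSite 3 L, ((∑ y : Fin 3 → Fin (2 ^ n), ∑ i : Fin 3,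
          cur (z + (fun k => ((y k : ℕ) : ZMod L)), i) θ) / (2 : ℝ) ^ (3 * n)) ^ 2) : ℝ) : ℂ)) → False by
    exact main _ hadm hW
  intro K hKadm hKW
  -- the block sums, the real exponent `F`, and the real density `e^F`
  set S : ℕ → (TorusSite 3 L → ℝ) → ℝ := fun n θ => ∑ z : TorusSite 3 L, ((∑ y : Fin 3 → Fin (2 ^ n), ∑ i : Fin 3,
      cur (z + (fun k => ((y k : ℕ) : ZMod L)), i) θ) / (2 : ℝ) ^ (3 * n)) ^ 2 with hSdef
  set F : (TorusSite 3 L → ℝ) → ℝ := fun θ =>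
    J * ∑ b : Bond L, Real.cos (θ (b.1 + Pi.single b.2 1) - θ b.1) + ε * c * ∑ n ∈ Finset.range N, S n θ with hFdef
  have hρF : ∀ θ, wJ J θ * Complex.exp (Wk K θ) = ((Real.exp (F θ) : ℝ) : ℂ) := by
    intro θ
    rw [hKW θ, ← Complex.ofReal_exp, wJ, ← Complex.ofReal_mul, ← Real.exp_add]
  have hFcont : Continuous F := by
    simp only [hFdef, hSdef]
    unfold cur
    fun_prop
  /- 5. Monotonicity and the two bounds on the block sums. -/
  have hSmono : ∀ θ (n : ℕ), 2 ≤ n → S n θ ≤ S 2 θ := by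
    intro θ n hn
    induction n, hn using Nat.le_induction with
    | base => exact le_rfl
    | succ m hm ih => exact le_trans (stub_e3BlockBounds L θ m).1 ih
  have hSle : ∀ θ (n : ℕ), S n θ ≤ 9 * (L : ℝ) ^ 3 := fun θ n => (stub_e3BlockBounds L θ n).2.1
  /- 6. Upper bound of `F` on the magnetised set. -/
  set RA : ℝ := 3 * J * (L : ℝ) ^ 3 + ε * c * (9 * (L : ℝ) ^ 3 * (N * (1 - ρ') + 2 * ρ')) with hRAdef
  have hsumcos_le : ∀ θ : TorusSite 3 L → ℝ,
      J * ∑ b : Bond L, Real.cos (θ (b.1 + Pi.single b.2 1) - θ b.1) ≤ 3 * J * (L : ℝ) ^ 3 := by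
    intro θ
    have h1 : ∑ b : Bond L, Real.cos (θ (b.1 + Pi.single b.2 1) - θ b.1) ≤ ∑ _b : Bond L, (1:ℝ) :=
      Finset.sum_le_sum fun b _ => Real.cos_le_one _
    rw [Finset.sum_const, Finset.card_univ, nsmul_eq_mul, mul_one, hcardB] at h1
    have := mul_le_mul_of_nonneg_left h1 hJ0
    linarith only [this]
  have hA : ∀ θ ∈ cube L,
      a / 2 * (L : ℝ) ^ 6 ≤ ∑ x : TorusSite 3 L, ∑ y : TorusSite 3 L, Real.cos (θ x - θ y) → F θ ≤ RA := by
    intro θ _ hmag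
    -- the second block sum is NOT near-maximal
    have hS2 : S 2 θ < (1 - ρ') * (9 * (L : ℝ) ^ 3) := by
      by_contra hge
      obtain ⟨h1, h2⟩ := stub_e3L2Rigidity L θ 2 ρ' (not_lt.1 hge)
      exact absurd hmag (not_le.2 (hrig' L θ 2 le_rfl h1 h2))
    -- hence the sum over scales is bounded away from its maximum
    have hsum : ∑ n ∈ Finset.range N, S n θ ≤ 9 * (L : ℝ) ^ 3 * (N * (1 - ρ') + 2 * ρ') := by
      have hsplit : ∑ n ∈ Finset.range N, S n θ =
          (S 0 θ + S 1 θ) + ∑ n ∈ Finset.Ico 2 N, S n θ := e3a_sum_range_split (fun n => S n θ) (by omega)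
      have htail : ∑ n ∈ Finset.Ico 2 N, S n θ ≤ ∑ _n ∈ Finset.Ico 2 N, (1 - ρ') * (9 * (L : ℝ) ^ 3) :=
        Finset.sum_le_sum fun n hn => ((hSmono θ n (Finset.mem_Ico.1 hn).1).trans hS2.le)
      rw [Finset.sum_const, Nat.card_Ico, nsmul_eq_mul, Nat.cast_sub (by omega : 2 ≤ N)] at htail
      have h0 := hSle θ 0
      have h1 := hSle θ 1
      rw [hsplit]
      simp only [Nat.cast_ofNat] at htail
      have hexp : ((N : ℝ) - 2) * ((1 - ρ') * (9 * (L : ℝ) ^ 3)) =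
          9 * (L : ℝ) ^ 3 * (N * (1 - ρ') + 2 * ρ') - 18 * (L : ℝ) ^ 3 := by ring
      rw [hexp] at htail
      linarith only [htail, h0, h1]
    have hεc : 0 ≤ ε * c := mul_nonneg hε.le hc0
    calc F θ = J * ∑ b : Bond L, Real.cos (θ (b.1 + Pi.single b.2 1) - θ b.1) +
          ε * c * ∑ n ∈ Finset.range N, S n θ := rfl
      _ ≤ 3 * J * (L : ℝ) ^ 3 + ε * c * (9 * (L : ℝ) ^ 3 * (N * (1 - ρ') + 2 * ρ')) :=
          add_le_add (hsumcos_le θ) (mul_le_mul_of_nonneg_left hsum hεc)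
  /- 7. Lower bound of `F` on the helix box. -/
  obtain ⟨hbox, hhel⟩ := stub_e3HelixBox L h4 δ hδpos.le hδpi
  set m : ℝ := 1 - 2 * δ ^ 2 with hmdef
  have hδ14 : δ ^ 2 ≤ 1 / 4 := by nlinarith only [hδhalf, hδpos]
  have hm0 : 0 ≤ m := by rw [hmdef]; linarith only [hδ14]
  have hm2 : 1 - 4 * δ ^ 2 ≤ m ^ 2 := by
    rw [hmdef]; nlinarith only [sq_nonneg (δ ^ 2)]
  set RN : ℝ := J * (3 * (L : ℝ) ^ 3 * (-(2 * δ))) + ε * c * (N * ((L : ℝ) ^ 3 * (3 * m) ^ 2)) with hRNdef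
  have hN' : ∀ θ ∈ (Set.pi Set.univ fun x : TorusSite 3 L =>
      Set.Icc ((fun x : TorusSite 3 L => Real.pi / 4 + Real.pi / 2 * ((((x 0).val + (x 1).val + (x 2).val) % 4 : ℕ) : ℝ)) x - δ)
        ((fun x : TorusSite 3 L => Real.pi / 4 + Real.pi / 2 * ((((x 0).val + (x 1).val + (x 2).val) % 4 : ℕ) : ℝ)) x + δ)),
      RN ≤ F θ := by
    intro θ hθ
    have hb := hhel θ hθ
    -- cosine part
    have hcos : J * (3 * (L : ℝ) ^ 3 * (-(2 * δ))) ≤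
        J * ∑ b : Bond L, Real.cos (θ (b.1 + Pi.single b.2 1) - θ b.1) := by
      have h1 : ∑ _b : Bond L, (-(2 * δ) : ℝ) ≤ ∑ b : Bond L, Real.cos (θ (b.1 + Pi.single b.2 1) - θ b.1) :=
        Finset.sum_le_sum fun b _ => (hb b).2
      rw [Finset.sum_const, Finset.card_univ, nsmul_eq_mul, hcardB] at h1
      exact mul_le_mul_of_nonneg_left h1 hJ0
    -- block part
    have hblk : (N : ℝ) * ((L : ℝ) ^ 3 * (3 * m) ^ 2) ≤ ∑ n ∈ Finset.range N, S n θ := by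
      have h1 : ∀ n ∈ Finset.range N, (L : ℝ) ^ 3 * (3 * m) ^ 2 ≤ S n θ :=
        fun n _ => (stub_e3BlockBounds L θ n).2.2 m hm0 (fun b => (hb b).1)
      have h2 := Finset.card_nsmul_le_sum (Finset.range N) (fun n => S n θ) _ h1
      rwa [Finset.card_range, nsmul_eq_mul] at h2
    have hεc : 0 ≤ ε * c := mul_nonneg hε.le hc0
    calc RN = J * (3 * (L : ℝ) ^ 3 * (-(2 * δ))) + ε * c * (N * ((L : ℝ) ^ 3 * (3 * m) ^ 2)) := rfl
      _ ≤ J * ∑ b : Bond L, Real.cos (θ (b.1 + Pi.single b.2 1) - θ b.1) + ε * c * ∑ n ∈ Finset.range N, S n θ :=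
          add_le_add hcos (mul_le_mul_of_nonneg_left hblk hεc)
      _ = F θ := rfl
  /- 8. Energy–entropy. -/
  have hLap := stub_e3Laplace L F hFcont a RA RN δ ha.le _ hδpos hbox hA hN'
  -- the plateau of the real kernel is the `e^F`-average of `Σ cos / L⁶`
  have hre : (cratio L J K).re =
      (∑ x : TorusSite 3 L, ∑ y : TorusSite 3 L, ∫ θ in cube L, Real.cos (θ x - θ y) * Real.exp (F θ)) /
        (∫ θ in cube L, Real.exp (F θ)) / (L : ℝ) ^ 6 := by
    rw [gr_re_cratio_of hρF]
    congr 1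
    rw [Finset.sum_div]
    refine Finset.sum_congr rfl fun x _ => ?_
    rw [Finset.sum_div]
  -- the crux's claim for this kernel
  obtain ⟨-, hplat⟩ := h J (le_max_left _ _) L hL2 K hKadm
  -- combine: `a ≤ a/2 + X`
  set X : ℝ := (2 * Real.pi) ^ Fintype.card (TorusSite 3 L) * Real.exp RA /
      ((2 * δ) ^ Fintype.card (TorusSite 3 L) * Real.exp RN) with hXdef
  have hL6 : (0:ℝ) < (L : ℝ) ^ 6 := by positivity
  have hplat' : a ≤ a / 2 + X := by
    rw [hre, le_div_iff₀ hL6] at hplat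
    have h1 : a * (L : ℝ) ^ 6 ≤ (a / 2 + X) * (L : ℝ) ^ 6 := by
      have := hplat.trans hLap
      linarith only [this]
    exact le_of_mul_le_mul_right h1 hL6
  /- 9. The error term is tiny: `X ≤ e^{-N} < a/2`. -/
  -- the difference of the two levels
  have hdiff : RA - RN ≤ (L : ℝ) ^ 3 * (3 * J * (1 + 2 * δ) - κ₀ * N) := by
    have hN8' : (8:ℝ) ≤ N := by exact_mod_cast hN8
    have hbr := e3a_bracket_le hN8' hρ'pos.le hm2 hδsq
    have hεcL : (0:ℝ) ≤ 9 * (ε * c) * (L : ℝ) ^ 3 := by positivity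
    have hid : RA - RN = 3 * J * (L : ℝ) ^ 3 * (1 + 2 * δ) +
        9 * (ε * c) * (L : ℝ) ^ 3 * (N * (1 - ρ') + 2 * ρ' - N * m ^ 2) := by
      simp only [hRAdef, hRNdef]; ring
    have hκid : (L : ℝ) ^ 3 * (3 * J * (1 + 2 * δ) - κ₀ * N) =
        3 * J * (L : ℝ) ^ 3 * (1 + 2 * δ) + 9 * (ε * c) * (L : ℝ) ^ 3 * (-(N * ρ') / 2) := by
      simp only [hκ₀def]; ring
    rw [hid, hκid]
    have := mul_le_mul_of_nonneg_left hbr hεcL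
    linarith only [this]
  have hX : X < a / 2 := by
    have hπδ : 0 < Real.pi / δ := div_pos Real.pi_pos hδpos
    have hX1 : X = (Real.pi / δ) ^ (L ^ 3) * Real.exp (RA - RN) := by
      rw [hXdef, hcardΛ]
      exact e3a_ratio_eq _ _ _ _ _
    have hexpo : ((L ^ 3 : ℕ) : ℝ) * Real.log (Real.pi / δ) + (RA - RN) ≤ -(N : ℝ) := by
      push_cast
      exact e3a_exponent_le (hLN.trans hL3) (by positivity) hA₀def hNA hdiff
    have hX2 : X ≤ Real.exp (-(N : ℝ)) := by
      rw [hX1]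
      exact e3a_pow_mul_exp_le hπδ _ hexpo
    exact hX2.trans_lt (e3a_exp_neg_lt ha hNa)
  linarith only [hplat', hX]

/-- **Exponent `3` is false** — the same statement under its natural name (alias of `stub_e3ExponentThreeFalse`). -/
theorem perturbedXYOrder_false_with_exponent_three :
    ¬ (∃ J₀ ε a : ℝ, 0 < ε ∧ 0 < a ∧ ∀ J : ℝ, J₀ ≤ J → ∀ (L : ℕ) [NeZero L], 2 ≤ L →
        ∀ K : Bond L → Bond L → ℂ,
          (∀ b b', ‖K b b'‖ ≤ ε / (1 + ((torusGraph 3 L).dist b.1 b'.1 : ℝ)) ^ 3) →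
            Zk J K ≠ 0 ∧ a ≤ (cratio L J K).re) :=
  stub_e3ExponentThreeFalse

end Summit.HubbardSuperconductivity.HubbardSuperconductivity.Theorems.PerturbedXYOrder

end
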